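/-
Copyright: cell pub-balaban-gaps (YM BLITZ Y1, track G1), seat g1-p2 GEN 7 (unit `pub-balaban-gaps-g1-p2`).  Row (D4) NODE O,
OBJECT level: the GENUINE covariant block-averaging projector `P_K(U) = Q_K(U)*Q_K(U)` of the one-scale torus family, built from
BLOCK-CONTOUR TRANSPORTERS `U(Γ_{y,x}) ∈ Matrix F F ℂ` (hypothesis family `Ug`, inverses `Ugi`): its entries
`[B(x) = B(x′)]·L^{−Kd}·(U(Γ_{y,x})⁻¹U(Γ_{y,x′}))_{ab}`, the flat projector's entries `[B(x) = B(x′)]·L^{−Kd}` (`Pk_apply`, from the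
tree's `avgMat`∕`extMat`), the block weight sum `Σ_{x′∈B(x)}L^{−Kd} = 1` (`card_fibre`), whence the averaging correction
`V_av = a_K(P_K⊗1 − P_K(U))` of `D4WalkBlockCovariantPropagator` IS cube-local with row window `a_K(2α_g + α_g²)` from the contour
letters `Σ_b|(U(Γ) − 1)_{ab}| ≤ α_g` — and 63's END for the GENUINE `(Δ_W + m² + a_KP_K(U))⁻¹`.  Also `alphaK_le`: `a_K ≤ a` (uniform in `K`).
HONEST FRAMING: `Ug`, `W^±` hypothesis families (for a lattice gauge field they are contour ∕ bond products of `e^{iηA}`, windows by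
61's exponential window — not composed here); (D4) instance 0∕1; NOT BetaPertH, NOT continuum, NOT Clay.
-/
import Summits.QuantumFields.BalabanUV.Gaps.D4WalkBlockCovariantPropagator

/-!
# `Gaps.D4WalkBlockCovariantBlockAveraging` — the genuine covariant block-averaging projector from block-contour transporters;
# cube-locality and row window of the averaging correction; the END for `(Δ_W + m² + a_KP_K(U))⁻¹` (cell pub-balaban-gaps, g1-p2 gen 7)

HONEST DEPENDENCY (cell pub-balaban, verbatim): continuum YM on T⁴ ⇐ BetaPertH ∧ nine spine estimates (0/9 proved);
BetaPertH ⇐ (D1) ∧ (D4) ∧ CAP+tail.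

* §1 `proj_lvl_eq_blk`, **`Pk_apply`** (`(Q*_KQ_K)_{xx′} = [B(x)=B(x′)]L^{−Kd}`), `sum_blockWeight` (`Σ_{x′}[B(x)=B(x′)]L^{−Kd} = 1`),
  `alphaK_le` (`a_K(L^Kη)⁻² = a_K ≤ a`), `alphaK_nonneg`.
* §2 `PU` (the covariant projector ⊗ fibre), `Vav_PU_apply`, `Vav_PU_local`, `rowSum_one_sub_mul_le`, **`Vav_PU_rowSum_le`**
  (row window `a_K(2α_g + α_g²)`), `differentiableOn_PU`.
* §3 **`blockWalkExpansion_covariantBlockAveraging_oneScaleTorus`** — 63's END with the genuine `P_K(U)`.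
References: T. Bałaban, Comm. Math. Phys. **99** (1985) 389–434 [B9], (3.8) p.392, (3.37) p.396, (3.57)–(3.61) pp.401–402, Cor. 3.5
p.407; CMP **85** (1982) (2.7), (2.11), (2.20).
-/

noncomputable section

namespace Summit.QuantumFields.BalabanUV.Gaps.D4WalkBlockCovariantBlockAveraging

open Metric Set Finset
open scoped Matrix
open Literature.MathematicalPhysics.QuantumFieldTheory.Balaban1983to89
open Literature.MathematicalPhysics.QuantumFieldTheory.Balaban1983to89.B9SectDWalk (DomBy)
open Literature.MathematicalPhysics.QuantumFieldTheory.Balaban1983to89.B9Thm34Ext (toB6)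
open Literature.MathematicalPhysics.QuantumFieldTheory.Balaban1983to89.B9Thm37GlueTorus (torusGeom tdist1)
open Literature.MathematicalPhysics.QuantumFieldTheory.Balaban1983to89.TreeLengthTorus (TPt)
open Literature.MathematicalPhysics.QuantumFieldTheory.Balaban1983to89.B5TorusCover (UT)
open Literature.MathematicalPhysics.QuantumFieldTheory.Balaban1983to89.B11SectG (RowSum)
open Literature.MathematicalPhysics.QuantumFieldTheory.Balaban1983to89.B5Ineq137Torus (Nv blk)
open Literature.MathematicalPhysics.QuantumFieldTheory.Balaban1983to89.B6Prop22OneScaleTorus (Index)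
open Literature.MathematicalPhysics.QuantumFieldTheory.Balaban1983to89.B1RG242Torus (tower Qk Qks lvl lvl_of_le avgMat extMat
  sitesPerDir_zero_eq winv_pow_mul_eq_one)
open Literature.MathematicalPhysics.QuantumFieldTheory.Balaban1983to89.Site (card_fibre)
open Summit.QuantumFields.BalabanUV.Gaps.D4WalkBlock (blockNorm BlockWalkExpansion)
open Summit.QuantumFields.BalabanUV.Gaps.D4WalkBlockFlatLetters (cubeOf cubeOf_eq_iff)
open Summit.QuantumFields.BalabanUV.Gaps.D4WalkBlockCovariantShift (covDop covB)
open Summit.QuantumFields.BalabanUV.Gaps.D4WalkBlockCovariantPropagator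
  (Pf Vav covOp blockWalkExpansion_covariantPropagator_oneScaleTorus)

/-! ## §1. The flat block-averaging projector's entries; the block weight sum; `a_K ≤ a` -/

section Flat
variable (P : Params)

/-- The averaging weight `L^{−Kd}` of `Q_K` (as the tree spells it, with exponent `lvl P K = K`). -/
def wK : ℝ := (((P.L : ℝ) ^ P.d)⁻¹) ^ lvl P P.K

/-- The tree's block map at level `K` is B5's `blk`: `proj K (lvl K) x = blk K x`. -/
theorem proj_lvl_eq_blk (x : Site P 0) : Site.proj P.K (lvl P P.K) x = blk P P.K x := by
  unfold blk Site.proj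
  rw [lvl_of_le P (Nat.le_add_left P.K P.m)]

/-- **`(Q*_KQ_K)_{xx′} = [B(x) = B(x′)]·L^{−Kd}`**. [cite: Balaban1982Higgs1, (2.11) p.609, (2.20) p.610] -/
theorem Pk_apply (x x' : Site P 0) :
    (Qks P P.K * Qk P P.K) x x' = if blk P P.K x = blk P P.K x' then wK P else 0 := by
  rw [Matrix.mul_apply, show Qks P P.K = extMat P 0 P.K (lvl P P.K) from rfl,
    show Qk P P.K = avgMat P 0 P.K (lvl P P.K) (wK P) from rfl]
  simp only [extMat, avgMat, proj_lvl_eq_blk]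
  rw [Finset.sum_eq_single (blk P P.K x) (fun y _ hy => by rw [if_neg (Ne.symm hy), zero_mul])
    (fun h => (h (Finset.mem_univ _)).elim), if_pos rfl, one_mul]
  by_cases h : blk P P.K x = blk P P.K x'
  · rw [if_pos h.symm, if_pos h]
  · rw [if_neg (fun h' => h h'.symm), if_neg h]

/-- **`Σ_{x′}[B(x) = B(x′)]·L^{−Kd} = 1`** (a block has `L^{Kd}` fine sites). -/
theorem sum_blockWeight (x : Site P 0) : ∑ x', (if blk P P.K x = blk P P.K x' then wK P else 0) = 1 := by
  rw [← Finset.sum_filter, Finset.sum_const, nsmul_eq_mul]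
  have hc := card_fibre (i := 0) (sitesPerDir_zero_eq P P.K) (blk P P.K x)
  have e : (Finset.univ.filter fun x' : Site P 0 => blk P P.K x = blk P P.K x') =
      Finset.univ.filter fun x' : Site P 0 => Site.proj P.K (lvl P P.K) x' = blk P P.K x := by
    ext x'; simp only [Finset.mem_filter, Finset.mem_univ, true_and, proj_lvl_eq_blk]; exact eq_comm
  rw [e, hc, wK]
  push_cast
  rw [mul_comm]
  exact winv_pow_mul_eq_one P (lvl P P.K)

/-- `0 ≤ L^{−Kd}`. -/
theorem wK_nonneg : 0 ≤ wK P := by unfold wK; positivity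

/-- **`a_K(L^Kη)⁻² ≤ a` uniformly in `K ≥ 1`** (`L^Kη = 1`, `a_K = a(1 − L⁻²)/(1 − L^{−2K})`). [cite: Balaban1982Higgs1, (2.13) p.609] -/
theorem alphaK_le {a : ℝ} (ha : 0 ≤ a) (hK : 1 ≤ P.K) : B1RG242Torus.α P a P.K ≤ a := by
  rw [B1RG242Torus.α, P.spacing_K, one_pow, inv_one, mul_one, B1.aSeq_eq]
  have hL : (1 : ℝ) < P.L := by exact_mod_cast P.hL.2
  have hq0 : 0 < ((P.L : ℝ) ^ 2)⁻¹ := by positivity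
  have hq1 : ((P.L : ℝ) ^ 2)⁻¹ < 1 := inv_lt_one_of_one_lt₀ (by nlinarith)
  have hpow : (((P.L : ℝ) ^ 2)⁻¹) ^ P.K ≤ ((P.L : ℝ) ^ 2)⁻¹ := by
    calc (((P.L : ℝ) ^ 2)⁻¹) ^ P.K ≤ (((P.L : ℝ) ^ 2)⁻¹) ^ 1 := pow_le_pow_of_le_one hq0.le hq1.le hK
      _ = _ := pow_one _
  have hden : 0 < 1 - (((P.L : ℝ) ^ 2)⁻¹) ^ P.K := by linarith
  rw [div_le_iff₀ hden]
  nlinarith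

/-- `0 ≤ a_K(L^Kη)⁻²` for `a ≥ 0`, `K ≥ 1`. -/
theorem alphaK_nonneg {a : ℝ} (ha : 0 ≤ a) (hK : 1 ≤ P.K) : 0 ≤ B1RG242Torus.α P a P.K := by
  rw [B1RG242Torus.α, P.spacing_K, one_pow, inv_one, mul_one, B1.aSeq_eq]
  have hL : (1 : ℝ) < P.L := by exact_mod_cast P.hL.2
  have hq0 : 0 < ((P.L : ℝ) ^ 2)⁻¹ := by positivity
  have hq1 : ((P.L : ℝ) ^ 2)⁻¹ < 1 := inv_lt_one_of_one_lt₀ (by nlinarith)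
  have hpow : (((P.L : ℝ) ^ 2)⁻¹) ^ P.K < 1 := pow_lt_one₀ hq0.le hq1 (by omega)
  exact div_nonneg (mul_nonneg ha (by linarith)) (by linarith)

end Flat

/-! ## §2. The covariant projector from block-contour transporters; locality, window, holomorphy of `V_av` -/

section Covariant
variable (P : Params) (F : Type) [Fintype F] [DecidableEq F]
variable {E : Type*} [NormedAddCommGroup E] [NormedSpace ℂ E]
variable (Ug Ugi : E → Site P 0 → Matrix F F ℂ) (a : ℝ)

/-- **The covariant block-averaging projector ⊗ fibre**: `P_K(U)_{(x,a),(x′,b)} = [B(x) = B(x′)]·L^{−Kd}·(U(Γ_{y,x})⁻¹U(Γ_{y,x′}))_{ab}`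
(`y` the common block; `Ug u x = U(Γ_{y,x})`, `Ugi` its inverse). [cite: Balaban1985BackgroundPropagators, (3.8) p.392; Balaban1982Higgs1, (2.7) p.608] -/
def PU (u : E) : Matrix (Site P 0 × F) (Site P 0 × F) ℂ :=
  Matrix.of fun p q => if blk P P.K p.1 = blk P P.K q.1 then (wK P : ℂ) * (Ugi u p.1 * Ug u q.1) p.2 q.2 else 0

omit [NormedAddCommGroup E] [NormedSpace ℂ E] in
/-- Entries of the averaging correction for the genuine projector:
`V_av = [B(x) = B(x′)]·a_K·L^{−Kd}·(1 − U(Γ_{y,x})⁻¹U(Γ_{y,x′}))_{ab}`. -/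
theorem Vav_PU_apply (u : E) (p q : Site P 0 × F) :
    Vav P F (PU P F Ug Ugi) a u p q = if blk P P.K p.1 = blk P P.K q.1 then
      (B1RG242Torus.α P a P.K : ℂ) * ((wK P : ℂ) * (1 - Ugi u p.1 * Ug u q.1) p.2 q.2) else 0 := by
  have hPf : Pf P F p q = if p.2 = q.2 then (if blk P P.K p.1 = blk P P.K q.1 then (wK P : ℂ) else 0) else 0 := by
    rw [Pf, show p = (p.1, p.2) from rfl, show q = (q.1, q.2) from rfl, Matrix.blockDiagonal_apply]
    by_cases h2 : p.2 = q.2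
    · rw [if_pos h2, if_pos h2, Matrix.map_apply, Pk_apply]; split_ifs <;> simp
    · rw [if_neg h2, if_neg h2]
  have hPU : PU P F Ug Ugi u p q = if blk P P.K p.1 = blk P P.K q.1 then (wK P : ℂ) * (Ugi u p.1 * Ug u q.1) p.2 q.2 else 0 := rfl
  rw [Vav, Matrix.smul_apply, Matrix.sub_apply, smul_eq_mul, hPf, hPU]
  by_cases h : blk P P.K p.1 = blk P P.K q.1
  · rw [if_pos h, if_pos h, if_pos h, Matrix.sub_apply, Matrix.one_apply]
    by_cases h2 : p.2 = q.2
    · rw [if_pos h2, if_pos h2]; ring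
    · rw [if_neg h2, if_neg h2]; ring
  · rw [if_neg h, if_neg h, if_neg h]
    split_ifs <;> simp

omit [NormedAddCommGroup E] [NormedSpace ℂ E] in
/-- `V_av` for the genuine projector is CUBE-LOCAL (it lives inside the blocks = the unit cubes). -/
theorem Vav_PU_local (u : E) (p q : Site P 0 × F) (h : Vav P F (PU P F Ug Ugi) a u p q ≠ 0) :
    cubeOf P p.1 = cubeOf P q.1 := by
  rw [Vav_PU_apply] at h
  by_cases hb : blk P P.K p.1 = blk P P.K q.1
  · exact cubeOf_eq_iff.2 hb
  · exact (h (by rw [if_neg hb])).elim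

/-- Fibre row sums of `1 − AB` from the letters of `A − 1` (rows) and `B − 1` (rows): at most `α + α′ + αα′`. -/
theorem rowSum_one_sub_mul_le (A B : Matrix F F ℂ) {α α' : ℝ} (hα' : 0 ≤ α')
    (hA : ∀ c, ∑ b, ‖(A - 1) c b‖ ≤ α) (hB : ∀ c, ∑ b, ‖(B - 1) c b‖ ≤ α') (c : F) :
    ∑ b, ‖(1 - A * B) c b‖ ≤ α + α' + α * α' := by
  classical
  have e : (1 : Matrix F F ℂ) - A * B = -((A - 1) + (B - 1) + (A - 1) * (B - 1)) := by noncomm_ring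
  rw [e]
  calc ∑ b, ‖(-((A - 1) + (B - 1) + (A - 1) * (B - 1))) c b‖
      = ∑ b, ‖((A - 1) + (B - 1) + (A - 1) * (B - 1)) c b‖ := Finset.sum_congr rfl fun b _ => by
          rw [Matrix.neg_apply, norm_neg]
    _ ≤ ∑ b, (‖(A - 1) c b‖ + ‖(B - 1) c b‖ + ∑ e, ‖(A - 1) c e‖ * ‖(B - 1) e b‖) := Finset.sum_le_sum fun b _ => by
          rw [Matrix.add_apply, Matrix.add_apply, Matrix.mul_apply]
          refine (norm_add_le _ _).trans (add_le_add (norm_add_le _ _) ((norm_sum_le _ _).trans ?_))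
          exact Finset.sum_le_sum fun e _ => (norm_mul_le _ _)
    _ = ∑ b, ‖(A - 1) c b‖ + ∑ b, ‖(B - 1) c b‖ + ∑ e, ‖(A - 1) c e‖ * ∑ b, ‖(B - 1) e b‖ := by
          rw [Finset.sum_add_distrib, Finset.sum_add_distrib, Finset.sum_comm]
          simp only [Finset.mul_sum]
    _ ≤ α + α' + α * α' := by
          refine add_le_add (add_le_add (hA c) (hB c)) ?_
          calc ∑ e, ‖(A - 1) c e‖ * ∑ b, ‖(B - 1) e b‖ ≤ ∑ e, ‖(A - 1) c e‖ * α' :=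
                Finset.sum_le_sum fun e _ => mul_le_mul_of_nonneg_left (hB e) (norm_nonneg _)
            _ = (∑ e, ‖(A - 1) c e‖) * α' := by rw [Finset.sum_mul]
            _ ≤ α * α' := mul_le_mul_of_nonneg_right (hA c) hα'

omit [NormedSpace ℂ E] in
/-- **ROW WINDOW OF THE GENUINE AVERAGING CORRECTION.**  If on the ball every block-contour transporter satisfies the letters
`Σ_b|(U(Γ_{y,x}) − 1)_{ab}| ≤ α_g`, `Σ_b|(U(Γ_{y,x})⁻¹ − 1)_{ab}| ≤ α_g` (print: `|U(Γ) − 1| ≤ e^{|Γ|ηα₁(Lʲη)⁻¹} − 1 = O(α₁)`, `|Γ| ≤ dLʲ`),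
then `Σ_q‖V_av(u)_{pq}‖ ≤ a_K(2α_g + α_g²)` — the block weights sum to one. [cite: Balaban1985BackgroundPropagators, (3.37) p.396, (3.57)–(3.60) pp.401–402] -/
theorem Vav_PU_rowSum_le {R αg : ℝ} (ha : 0 ≤ a) (hK : 1 ≤ P.K) (hαg : 0 ≤ αg)
    (hUg : ∀ u ∈ ball (0 : E) R, ∀ x c, ∑ b, ‖(Ug u x - 1) c b‖ ≤ αg)
    (hUgi : ∀ u ∈ ball (0 : E) R, ∀ x c, ∑ b, ‖(Ugi u x - 1) c b‖ ≤ αg) :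
    ∀ u ∈ ball (0 : E) R, ∀ p, ∑ q, ‖Vav P F (PU P F Ug Ugi) a u p q‖ ≤ B1RG242Torus.α P a P.K * (2 * αg + αg ^ 2) := by
  intro u hu p
  have hαK := alphaK_nonneg P ha hK
  have hw := wK_nonneg P
  calc ∑ q, ‖Vav P F (PU P F Ug Ugi) a u p q‖
      = ∑ x', ∑ b, ‖Vav P F (PU P F Ug Ugi) a u p (x', b)‖ := by
          rw [← Finset.univ_product_univ, Finset.sum_product]
    _ ≤ ∑ x', (if blk P P.K p.1 = blk P P.K x' then wK P else 0) * (B1RG242Torus.α P a P.K * (2 * αg + αg ^ 2)) :=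
          Finset.sum_le_sum fun x' _ => by
            by_cases hb : blk P P.K p.1 = blk P P.K x'
            · rw [if_pos hb]
              calc ∑ b, ‖Vav P F (PU P F Ug Ugi) a u p (x', b)‖
                  = ∑ b, B1RG242Torus.α P a P.K * (wK P * ‖(1 - Ugi u p.1 * Ug u x') p.2 b‖) :=
                    Finset.sum_congr rfl fun b _ => by
                      rw [Vav_PU_apply, if_pos hb, norm_mul, norm_mul, Complex.norm_real, Complex.norm_real,
                        Real.norm_of_nonneg hαK, Real.norm_of_nonneg hw]
                _ = wK P * (B1RG242Torus.α P a P.K * ∑ b, ‖(1 - Ugi u p.1 * Ug u x') p.2 b‖) := by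
                    rw [← Finset.mul_sum, ← Finset.mul_sum]; ring
                _ ≤ wK P * (B1RG242Torus.α P a P.K * (2 * αg + αg ^ 2)) := by
                    refine mul_le_mul_of_nonneg_left (mul_le_mul_of_nonneg_left ?_ hαK) hw
                    have h := rowSum_one_sub_mul_le F (Ugi u p.1) (Ug u x') hαg (hUgi u hu p.1) (hUg u hu x') p.2
                    nlinarith
            · rw [if_neg hb, zero_mul]
              refine (Finset.sum_eq_zero fun b _ => ?_).le
              rw [Vav_PU_apply, if_neg hb, norm_zero]
    _ = B1RG242Torus.α P a P.K * (2 * αg + αg ^ 2) := by rw [← Finset.sum_mul, sum_blockWeight, one_mul]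

omit [DecidableEq F] in
/-- Entries of the genuine projector are holomorphic when the transporters' entries are. -/
theorem differentiableOn_PU {s : Set E} (hUg : ∀ x c b, DifferentiableOn ℂ (fun u => Ug u x c b) s)
    (hUgi : ∀ x c b, DifferentiableOn ℂ (fun u => Ugi u x c b) s) (p q : Site P 0 × F) :
    DifferentiableOn ℂ (fun u => PU P F Ug Ugi u p q) s := by
  simp only [PU, Matrix.of_apply]
  by_cases h : blk P P.K p.1 = blk P P.K q.1
  · simp only [h, if_true, Matrix.mul_apply]
    exact (differentiableOn_const _).mul (DifferentiableOn.fun_sum fun c _ => (hUgi p.1 p.2 c).mul (hUg q.1 c q.2))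
  · simp only [h, if_false]; exact differentiableOn_const _

end Covariant

/-! ## §3. The END for the genuine covariant block averaging -/

section Step
variable {d L : ℕ} {a msq : ℝ}
variable {dd N' : ℕ} {E : Type*} [NormedAddCommGroup E] [NormedSpace ℂ E]

/-- **[B9] COR. 3.5 ON THE ONE-SCALE TORUS FAMILY FOR `(Δ_W + m² + a_KQ_K(U)*Q_K(U))⁻¹` WITH THE GENUINE COVARIANT AVERAGING.**
There are `δ₀, C > 0` (B6's) such that for every member `i`, every finite fibre `F`, every holomorphic family of transport defects `W^±`
with the bond window `ηα` and the divergence window `η²α′`, every holomorphic family of block-contour transporters `U(Γ_{y,x})(u)` with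
inverses and the contour letters `α_g` (rows of `U(Γ) − 1`, `U(Γ)⁻¹ − 1`), every cube row sum `(μ, c_μ)`, rates `0 ≤ μ`, `2μ ≤ ε`,
`2μ ≤ ½δ₀ − ε − μ` and the margin with `α_av = a_K(2α_g + α_g²)`: `u ↦ (Δ_W(u) + m² + a_KP_K(U)(u))⁻¹` with the GENUINE covariant
block-averaging projector is a block walk expansion at `(ε − 2μ, ½δ₀ − ε − 3μ, ·, ½δ₀ − 2μ)` with the relative derivative letters `covB δ₀`
and dominating distances; NO constant depends on `K` (`a_K ≤ a`), the volume or the fibre. [cite: Balaban1985BackgroundPropagators, Cor. 3.5 p.407, (3.8) p.392, (3.50)–(3.64) pp.400–402; Balaban1984PropagatorsII, Prop. 2.2 (2.67) p.234] -/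
theorem blockWalkExpansion_covariantBlockAveraging_oneScaleTorus (hd : 1 ≤ d) (hL : Odd L ∧ 1 < L) (ha : 0 < a) (hmsq : 0 ≤ msq) :
    ∃ δ₀ C : ℝ, 0 < δ₀ ∧ 0 < C ∧ ∀ (i : Index d L) (F : Type) [Fintype F] [DecidableEq F] (c₀ : B13.Consts)
      (X : Finset (UT (Nv i.P i.P.K))) (R : ℝ) (Wp Wm : Fin i.P.d → E → Site i.P 0 → Matrix F F ℂ)
      (Ug Ugi : E → Site i.P 0 → Matrix F F ℂ) (α α' αg ε μ cμ : ℝ),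
      (∀ ν x a' b, DifferentiableOn ℂ (fun u => Wp ν u x a' b) (ball (0 : E) R)) →
      (∀ ν x a' b, DifferentiableOn ℂ (fun u => Wm ν u x a' b) (ball (0 : E) R)) →
      (∀ x a' b, DifferentiableOn ℂ (fun u => Ug u x a' b) (ball (0 : E) R)) →
      (∀ x a' b, DifferentiableOn ℂ (fun u => Ugi u x a' b) (ball (0 : E) R)) →
      0 ≤ α → 0 ≤ α' → 0 ≤ αg →
      (∀ ν, ∀ u ∈ ball (0 : E) R, ∀ x a', ∑ b, ‖Wp ν u x a' b‖ ≤ i.P.eps * α) →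
      (∀ ν, ∀ u ∈ ball (0 : E) R, ∀ x a', ∑ b, ‖Wm ν u x a' b‖ ≤ i.P.eps * α) →
      (∀ u ∈ ball (0 : E) R, ∀ x a', ∑ b, ‖(∑ ν, (Wp ν u x + Wm ν u x)) a' b‖ ≤ i.P.eps ^ 2 * α') →
      (∀ u ∈ ball (0 : E) R, ∀ x c, ∑ b, ‖(Ug u x - 1) c b‖ ≤ αg) →
      (∀ u ∈ ball (0 : E) R, ∀ x c, ∑ b, ‖(Ugi u x - 1) c b‖ ≤ αg) →
      0 ≤ μ → 2 * μ ≤ ε → 2 * μ ≤ δ₀ / 2 - ε - μ → 0 ≤ cμ →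
      RowSum (toB6 (torusGeom (Nv i.P i.P.K) 0 0 0) 0 True) μ cμ →
      cμ * (cμ * 1 * (1 * ((α' + B1RG242Torus.α i.P a i.P.K * (2 * αg + αg ^ 2) + ∑ ι, α * covB i.P δ₀ ι) * C)) * cμ) * cμ < 1 →
      ∃ (W : Type) (T : W → (TPt dd N' → ℂ) → E → Matrix (Site i.P 0 × F) (Site i.P 0 × F) ℂ) (SX' : Set W) (A' : W → ℝ)
        (D' : W → UT (Nv i.P i.P.K) → UT (Nv i.P i.P.K) → ℝ),
        BlockWalkExpansion c₀ (fun q : Site i.P 0 × F => cubeOf i.P q.1) (fun q : Site i.P 0 × F => cubeOf i.P q.1)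
          (fun (_ : TPt dd N' → ℂ) u => (covOp i.P F Wp Wm (PU i.P F Ug Ugi) a msq u)⁻¹) X R
          (ε - 2 * μ) (δ₀ / 2 - ε - μ - 2 * μ)
          (cμ * C * (1 * (1 - cμ * (cμ * 1 * (1 * ((α' + B1RG242Torus.α i.P a i.P.K * (2 * αg + αg ^ 2) +
            ∑ ι, α * covB i.P δ₀ ι) * C)) * cμ) * cμ)⁻¹) * cμ)
          T SX' A' D' (δ₀ / 2 - 2 * μ) ∧
        (∀ (ι : Fin i.P.d ⊕ Fin i.P.d) ω (σ : TPt dd N' → ℂ), (∀ j, ‖σ j‖ ≤ Real.exp c₀.κ₁) → ∀ u ∈ ball (0 : E) R, ∀ Y Y',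
          blockNorm (fun q : Site i.P 0 × F => cubeOf i.P q.1) (fun q : Site i.P 0 × F => cubeOf i.P q.1)
              (covDop i.P F ι * T ω σ u) Y Y' ≤
            covB i.P δ₀ ι * (A' ω * Real.exp (-((δ₀ / 2 - 2 * μ) * D' ω Y Y')))) ∧
        ∀ ω, DomBy (toB6 (torusGeom (Nv i.P i.P.K) 0 0 0) 0 True) (D' ω) := by
  obtain ⟨δ₀, C, hδ₀, hC, h⟩ :=
    blockWalkExpansion_covariantPropagator_oneScaleTorus (dd := dd) (N' := N') (E := E) (a := a) (msq := msq) hd hL ha hmsq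
  refine ⟨δ₀, C, hδ₀, hC, fun i F _ _ c₀ X R Wp Wm Ug Ugi α α' αg ε μ cμ hWph hWmh hUgh hUgih hα hα' hαg hWp hWm hdiv hUg hUgi hμ
    hμε hμκ hcμ hrow hq => ?_⟩
  exact h i F c₀ X R Wp Wm (PU i.P F Ug Ugi) α α' (B1RG242Torus.α i.P a i.P.K * (2 * αg + αg ^ 2)) ε μ cμ hWph hWmh
    (differentiableOn_PU i.P F Ug Ugi (fun x c b => hUgh x c b) (fun x c b => hUgih x c b)) hα hα'
    (mul_nonneg (alphaK_nonneg i.P ha.le i.hK) (by positivity)) hWp hWm hdiv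
    (fun u p q hne => Vav_PU_local i.P F Ug Ugi a u p q hne)
    (Vav_PU_rowSum_le i.P F Ug Ugi a ha.le i.hK hαg hUg hUgi) hμ hμε hμκ hcμ hrow hq

end Step

/-! ## §4. (v1.1) The flat case: at trivial transporters the covariant projector IS `P_K ⊗ 1` and the correction vanishes -/

section FlatCase
variable (P : Params) (F : Type) [Fintype F] [DecidableEq F] {E : Type*} (a : ℝ)

omit [Fintype F] in
/-- Entries of the flat projector `P_K ⊗ 1_F`: `[a = b]·[B(x) = B(x′)]·L^{−Kd}`. -/
theorem Pf_apply (p q : Site P 0 × F) :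
    Pf P F p q = if p.2 = q.2 then (if blk P P.K p.1 = blk P P.K q.1 then (wK P : ℂ) else 0) else 0 := by
  rw [Pf, show p = (p.1, p.2) from rfl, show q = (q.1, q.2) from rfl, Matrix.blockDiagonal_apply]
  by_cases h2 : p.2 = q.2
  · rw [if_pos h2, if_pos h2, Matrix.map_apply, Pk_apply]; split_ifs <;> simp
  · rw [if_neg h2, if_neg h2]

/-- **At trivial block-contour transporters `U(Γ) ≡ 1` the covariant projector is the flat one**: `P_K(1) = P_K ⊗ 1_F`.
[cite: Balaban1985BackgroundPropagators, (3.8) p.392; Balaban1982Higgs1, (2.7) p.608] -/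
theorem PU_one (u : E) : PU P F (fun (_ : E) (_ : Site P 0) => (1 : Matrix F F ℂ)) (fun _ _ => 1) u = Pf P F := by
  ext p q
  rw [Pf_apply, PU, Matrix.of_apply, Matrix.one_mul, Matrix.one_apply]
  by_cases h : blk P P.K p.1 = blk P P.K q.1
  · rw [if_pos h]; split_ifs <;> simp
  · rw [if_neg h]; split_ifs <;> simp

/-- … and the averaging correction `V_av = a_K(P_K ⊗ 1 − P_K(U))` vanishes there. -/
theorem Vav_PU_one (u : E) : Vav P F (PU P F (fun (_ : E) (_ : Site P 0) => (1 : Matrix F F ℂ)) (fun _ _ => 1)) a u = 0 := by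
  rw [Vav, PU_one, sub_self, smul_zero]

omit [DecidableEq F] in
/-- `P_K(U)` is BLOCK-LOCAL: its entries vanish across averaging blocks (hence across unit cubes). -/
theorem PU_local (Ug Ugi : E → Site P 0 → Matrix F F ℂ) (u : E) (p q : Site P 0 × F) (h : PU P F Ug Ugi u p q ≠ 0) :
    blk P P.K p.1 = blk P P.K q.1 := by
  by_contra hb
  exact h (by rw [PU, Matrix.of_apply, if_neg hb])

/-- `0 < L^{−Kd}` for `L ≥ 1`. -/
theorem wK_pos (hL : 0 < P.L) : 0 < wK P := by
  have : (0 : ℝ) < (P.L : ℝ) := by exact_mod_cast hL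
  unfold wK; positivity

end FlatCase

end Summit.QuantumFields.BalabanUV.Gaps.D4WalkBlockCovariantBlockAveraging

end
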